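import Summits.ABC.IUTFork.Cor312LicenceShallowReal
import Summits.ABC.IUTFork.Cor312SlotHull
import HarnessLib

/-!
# [IUTchIII] Cor. 3.12 at the sharp real settings — the SLOT licence (reading (P): q-pilot region inside the hull of the (Ind2)-SLOT
# images, NO capsule permutation) FOLLOWS FROM THE SAME ONE-FACTOR (Ind2)-MOVERS as the (U)-licence: the γ line's S-side clause is
# INHABITED exactly where abc-iut-w5-d236's mover assembly inhabits the (xi-f) licence

PROOF-ONLY record file (D-0012; 0 definitions, 0 `Prop` facts) of the abc-iut cell (branch C certificate seat abc-iut-C-cert-2 gen 3; the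
NON-VACUITY companion of the γ certificate `Conditional.abc_of_slotLicence_orNumP_K_szpiroBad`, p458998, over the slot-hull vocabulary
`Cor312SlotHull.lean`, p458847). TAKES NO SIDE on [IUTchIII] Cor. 3.12 (S. Mochizuki, *Inter-universal Teichmüller theory III*, kurims
manuscript, Cor. 3.12 p. 173–174, Step (x) p. 181, Step (xi-f) p. 184 l. 26–29; Thm. 3.11 (i) (Ind2) p. 154) or on any author.

THE OBSERVATION. abc-iut-w5-d236's packet assembly `Thm311.Real.qRegion_subset_thetaHull_settingDHVolSharp_of_movers` (`Cor312LicenceShallowReal`,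
the engine under EVERY inhabited-licence theorem of record: abc-iut-w5-d009's tame iff p448597/p449282, abc-iut-D1-prv's boundary stratum
p456193/p456372, the shallow window) moves the box point `1 ⊗ ⋯ ⊗ 1 ⊗ t_{Θ,j,v_j}` by an (Ind2)-FAMILY acting on the LAST capsule slot — it NEVER
uses a capsule permutation or a strip automorphism, i.e. nothing of (Ind1). Hence the SAME proof places the q-pilot region inside the hull of
the union of the (Ind2)-SLOT images (`Cor312.Setting.thetaSlotHull`), i.e. proves the SLOT licence of the γ line:

* **`qRegion_subset_thetaSlotHull_settingDHVolSharp_of_movers`** — w5-d236's theorem VERBATIM with `thetaHull ↦ thetaSlotHull` (the moved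
  point is a member of `⋃₀ thetaSlotImages` because the moving family lies in `LogShells.Ind2Family`);
* **`slotLicence_settingDHVolSharp_of_movers`**, **`slotLicence_settingPrVolSharp_of_movers`** (`Cor312.Setting.SlotLicence` at abc-iut-c312-3's /
  abc-iut-c312-7's sharp settings from movers at the labels of `𝔽_l^⋇`; the two settings share regions, frames and indeterminacies —
  `slotLicence_settingPrVolSharp_iff_settingDHVolSharp` is `Iff.rfl`, like w4-d026's `licence_settingPrVolSharp_iff_settingDHVolSharp`).
In general only `SlotLicence ⟹ Licence` (`Cor312.Setting.licence_of_slotLicence`); what this file shows is that on the MOVER-DECIDED data the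
two licences hold TOGETHER.

CONSEQUENCE FOR THE C SCOREBOARD (γ line): the single number-level binder `hNumPOffBad` of p458998 («¬ SlotLicence → T.Cor312PerImageOf») is
NOT consumed at any genuine datum where the movers exist (uniformly tame shallow fibres by w5-d009's integer predicate, the tame boundary, …) —
exactly the data at which the (U) line consumes nothing either; there the per-image Corollary is a theorem modulo the READ-P bound.
HONEST SCOPE: statements about OUR typed sharp containers and Dupuy–Hilado's typed (Ind2); the slot licence is a STRONGER-THAN-PRINT reading;
nothing here asserts or refutes [IUTchIII] Cor. 3.12 or bears on the printed global inequality. [cite: DupuyHilado2025, §3.9, §4.9, §4.11–4.12]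
[claim: Mochizuki2012, status: disputed] for every IUT sentence quoted. typed ≠ proved; instantiated ≠ endorsed.
-/

noncomputable section

open Set Function
open scoped Pointwise

namespace Summit.ABC.IUTFork.Thm311.Real

open Cor312 Cor312.Setting Cor312Vol Literature.IUT.LogThetaLattice Literature.IUT.LogVolume NumberField IsDedekindDomain

variable {F : Type} [Field F] [NumberField F] (X : PilotData F) {logv : PadicLogs F} (hlog : LogvAnalytic logv)
  (M : Type) [Field M] [NumberField M]
  (archPk : ∀ (j : (thetaIndex X).Label) (vQ : (thetaIndex X).VQ), Set ((logShellsDH X logv).Packet j vQ))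
  (archSub : ∀ (j : (thetaIndex X).Label) (v : (thetaIndex X).V),
    Set ((logShellsDH X logv).Packet j ((thetaIndex X).over v)))
  (Ψ : ℤ → ∀ v : (thetaIndex X).V, v ∈ (thetaIndex X).Vbad → Set ((logShellsDH X logv).StarPacket v))
  (act : ℤ → ∀ v : (thetaIndex X).V, v ∈ (thetaIndex X).Vbad →
    (logShellsDH X logv).StarPacket v → Module.End ℚ ((logShellsDH X logv).StarPacket v))
  (Mmod : ℤ → ∀ j : (thetaIndex X).LabelStar, Set ((logShellsDH X logv).GlobalPacket j.1))
  (region : ℤ → ∀ j : (thetaIndex X).LabelStar, FinDivisor M → ∀ vQ : (thetaIndex X).VQ,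
    Set ((logShellsDH X logv).Packet j.1 vQ))
  (n : ℤ) {HT : Type} {LogLink : HT → HT → Type} {IsFull : ∀ {s t : HT}, LogLink s t → Prop}
  (lat : LGPGaussianLogThetaLattice LogLink IsFull)
  {Frd : Type} {IsoF : Frd → Frd → Type} {Ob : Frd → Type} {realify : Frd → Frd} {Strip : Type}
  {IsoS : Strip → Strip → Type} {Mv : ∀ v : (thetaIndex X).V, v ∈ (thetaIndex X).Vbad → Type}
  [∀ v h, Monoid (Mv v h)]
  (sig : GlobalLGPFrobenioidSignature (thetaIndex X).lstar (thetaIndex X).V (· ∈ (thetaIndex X).Vbad)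
    Frd IsoF Ob realify Strip IsoS Mv)
  (split : SplittingMonoids Mv) {ObΔ : Type} {N : ∀ v : (thetaIndex X).V, v ∈ (thetaIndex X).Vbad → Type}
  [∀ v h, Monoid (N v h)] (qData : QPilotData ObΔ N)
  (tq : ∀ (pp : Nat.Primes) (x : (thetaIndex X).Fibre (.inr pp)), haveI : Fact (pp : ℕ).Prime := ⟨pp.2⟩; kOf X pp.1 x)
  (t : ∀ (pp : Nat.Primes) (_ : Fin X.lstar) (x : (thetaIndex X).Fibre (.inr pp)),
    haveI : Fact (pp : ℕ).Prime := ⟨pp.2⟩; kOf X pp.1 x)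
  (htq0 : ∀ pp x, tq pp x ≠ 0)
  (htq1 : ∀ (pp : Nat.Primes) (x : (thetaIndex X).Fibre (.inr pp)),
    haveI : Fact (pp : ℕ).Prime := ⟨pp.2⟩; placeOf X pp.1 x ∉ X.S → ‖tq pp x‖ = 1)
  (col : ℤ → Column (logShellsDH X logv))

/-- **q-REGION ⊆ SLOT HULL AT `(j, v_ℚ)` FROM ONE-FACTOR MOVERS** (sharp real setting `settingDHVolSharp`): if at every place `x | p` some
`g ∈ Real.ismDH logv x` has `‖t_{q,x}‖ ≤ ‖g(t_{Θ,j,x})‖` (`t_{Θ,0,x} := 1`), then the q-pilot region at `(j, p)` lies in the hull of the union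
of the (Ind2)-SLOT images of the Θ-region (`Cor312.Setting.thetaSlotHull`); at `v_ℚ = ∞` unconditionally. abc-iut-w5-d236's
`qRegion_subset_thetaHull_settingDHVolSharp_of_movers` VERBATIM except that the moved point is booked in `⋃₀ thetaSlotImages` (its mover family lies in
`LogShells.Ind2Family`). [claim: Mochizuki2012, status: disputed] [cite: DupuyHilado2025, §3.9, §4.9, §4.11] -/
theorem qRegion_subset_thetaSlotHull_settingDHVolSharp_of_movers (j : (thetaIndex X).Label) (vQ : (thetaIndex X).VQ)
    (hmov : ∀ (pp : Nat.Primes) (x : (thetaIndex X).Fibre (.inr pp)),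
      haveI : Fact (pp : ℕ).Prime := ⟨pp.2⟩
      ∃ g ∈ ismDH logv x.1,
        ‖tq pp x‖ ≤ ‖(presAt X hlog pp).φ x (g (((presAt X hlog pp).φ x).symm (labelIdele X t pp j x)))‖) :
    (settingDHVolSharp X hlog M archPk archSub Ψ act Mmod region n lat sig split qData tq t htq0 htq1).qRegion j vQ ⊆
      (settingDHVolSharp X hlog M archPk archSub Ψ act Mmod region n lat sig split qData tq t htq0 htq1).thetaSlotHull j vQ := by
  set P := settingDHVolSharp X hlog M archPk archSub Ψ act Mmod region n lat sig split qData tq t htq0 htq1 with hP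
  show factorMapDH X hlog j vQ ⁻¹' hullSet (factorFieldDH X hlog j vQ) (qCentreDH X hlog tq j vQ) ⊆
    (HullFrame.ofComparison (factorFieldDH X hlog j vQ) (factorMapDH X hlog j vQ)).hull (⋃₀ P.thetaSlotImages j vQ)
  refine HullFrame.preimage_hullSet_subset_hull_ofComparison (factorFieldDH X hlog j vQ) (factorMapDH X hlog j vQ) _ _ ?_
  cases vQ with
  | inl u => exact fun s => s.elim
  | inr pp =>
    haveI : Fact (pp : ℕ).Prime := ⟨pp.2⟩
    set L := logShellsDH X logv with hL
    set Pr := presAt X hlog pp with hPr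
    -- the movers, acting on the LAST capsule slot only
    choose g hg hgn using hmov pp
    let G : (thetaIndex X).Caps j → ∀ x : (thetaIndex X).Fibre (.inr pp), L.carrier x.1 ≃ₗ[ℚ] L.carrier x.1 :=
      fun a x => if a = Fin.last _ then g x else LinearEquiv.refl ℚ _
    have hG : ∀ a x, G a x ∈ L.ism x.1 := by
      intro a x
      by_cases ha : a = Fin.last _
      · simp only [G, if_pos ha]; exact hg x
      · simp only [G, if_neg ha]; exact L.one_mem_ism x.1
    obtain ⟨Φ, hΦ, hΦj⟩ := L.exists_mem_Ind2Family_apply_eq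
      (show L.factorwise j (.inr pp) (fun a => L.summandwise (.inr pp) (G a)) ∈ L.Ind2 j (.inr pp) from ⟨G, hG, rfl⟩)
    -- the point `x₀ = 1 ⊗ ⋯ ⊗ 1 ⊗ t_{Θ,j,v_j}` of the Θ-box at every summand
    let y : (thetaIndex X).Caps j → L.Packet1 (.inr pp) := fun a x =>
      (Pr.φ x).symm (Pi.mulSingle (M := fun _ : (thetaIndex X).Caps j => Pr.k x) (Fin.last _) (labelIdele X t pp j x) a)
    let x₀ : L.Packet j (.inr pp) := PiTensorProduct.tprod ℚ y
    have hcmp : ∀ e : (thetaIndex X).Caps j → (thetaIndex X).Fibre (.inr pp),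
        Pr.comparison j x₀ e = iota pp.1 (Pr.kk e) (Fin.last _) (labelIdele X t pp j (e (Fin.last _))) := by
      intro e
      rw [Pr.comparison_tprod, iota_eq_purePacket]
      refine congrArg (PiTensorProduct.tprod ℚ_[pp]) (funext fun a => ?_)
      rcases eq_or_ne a (Fin.last _) with rfl | ha
      · simp [y]
      · simp [y, Pi.mulSingle_eq_of_ne ha]
    have hx₀ : x₀ ∈ P.thetaRegion3 j (.inr pp) := by
      rw [hP, settingDHVolSharp, thetaRegion3_thetaBoxDH]
      show (fun z => Pr.factorMap j z) x₀ ∈ Pr.boxOf (sharpBoxDH X hlog t pp j)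
      intro e
      refine ⟨Pr.comparison j x₀ e, ?_, fun i => rfl⟩
      rw [hcmp e]
      exact ⟨1, Subring.one_mem _, mul_one _⟩
    -- the moved point and its factor norms
    have hu : Φ j (.inr pp) x₀ ∈ ⋃₀ P.thetaSlotImages j (.inr pp) :=
      Set.mem_sUnion.2 ⟨_, ⟨Φ, hΦ, rfl⟩, Set.mem_image_of_mem _ hx₀⟩
    have hcmp' : ∀ e : (thetaIndex X).Caps j → (thetaIndex X).Fibre (.inr pp),
        Pr.comparison j (Φ j (.inr pp) x₀) e =
          iota pp.1 (Pr.kk e) (Fin.last _)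
            (Pr.φ (e (Fin.last _)) (g _ ((Pr.φ (e (Fin.last _))).symm (labelIdele X t pp j (e (Fin.last _)))))) := by
      intro e
      let y' : (thetaIndex X).Caps j → L.Packet1 (.inr pp) := fun a x => G a x (y a x)
      have hΦx : Φ j (.inr pp) x₀ = PiTensorProduct.tprod ℚ y' := by
        rw [hΦj]
        exact PiTensorProduct.congr_tprod (fun a => L.summandwise (.inr pp) (G a)) y
      rw [hΦx, Pr.comparison_tprod, iota_eq_purePacket]
      refine congrArg (PiTensorProduct.tprod ℚ_[pp]) (funext fun a => ?_)
      rcases eq_or_ne a (Fin.last _) with rfl | ha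
      · simp [y', y, G]
        rfl
      · simp [y', y, G, ha]
    rintro ⟨e, i⟩
    refine ⟨Φ j (.inr pp) x₀, hu, ?_⟩
    show ‖dEquiv pp.1 (Pr.kk e) (iota pp.1 (Pr.kk e) (Fin.last _) (tq pp (e (Fin.last _)))) i‖ ≤
      ‖dEquiv pp.1 (Pr.kk e) (Pr.comparison j (Φ j (.inr pp) x₀) e) i‖
    rw [hcmp' e, norm_dEquiv_iota, norm_dEquiv_iota]
    exact hgn _

/-! ## The slot licence from movers -/

/-- **THE SLOT LICENCE AT `settingDHVolSharp` FROM ONE-FACTOR MOVERS**: movers at every prime, label `j = i+1 ∈ 𝔽_l^⋇` and place `x | p` give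
`Cor312.Setting.SlotLicence` (the γ line's S-side clause) at abc-iut-c312-3's sharp real setting. [claim: Mochizuki2012, status: disputed]
[cite: DupuyHilado2025, §3.9, §4.9, §4.12] -/
theorem slotLicence_settingDHVolSharp_of_movers
    (hmov : ∀ (pp : Nat.Primes) (i : Fin (thetaIndex X).lstar) (x : (thetaIndex X).Fibre (.inr pp)),
      haveI : Fact (pp : ℕ).Prime := ⟨pp.2⟩
      ∃ g ∈ ismDH logv x.1,
        ‖tq pp x‖ ≤ ‖(presAt X hlog pp).φ x (g (((presAt X hlog pp).φ x).symm (t pp i x)))‖) :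
    (settingDHVolSharp X hlog M archPk archSub Ψ act Mmod region n lat sig split qData tq t htq0 htq1).SlotLicence := by
  intro i vQ
  refine qRegion_subset_thetaSlotHull_settingDHVolSharp_of_movers X hlog M archPk archSub Ψ act Mmod region n lat sig split qData
    tq t htq0 htq1 (labelSucc i) vQ fun pp x => ?_
  haveI : Fact (pp : ℕ).Prime := ⟨pp.2⟩
  rw [labelIdele_labelSucc]
  exact hmov pp i x

/-- The slot licence at the print-normalised sharp setting `settingPrVolSharp` IS the slot licence at `settingDHVolSharp` (same regions, frames,
indeterminacies — definitionally, like `licence_settingPrVolSharp_iff_settingDHVolSharp`). [folklore] -/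
theorem slotLicence_settingPrVolSharp_iff_settingDHVolSharp :
    (settingPrVolSharp X hlog M archPk archSub Ψ act Mmod region n lat sig split qData tq t htq0 htq1).SlotLicence ↔
      (settingDHVolSharp X hlog M archPk archSub Ψ act Mmod region n lat sig split qData tq t htq0 htq1).SlotLicence :=
  Iff.rfl

/-- **THE SLOT LICENCE AT `settingPrVolSharp` FROM ONE-FACTOR MOVERS** (abc-iut-c312-7's print-normalised sharp setting — the setting of every
K-line certificate of branch C). [claim: Mochizuki2012, status: disputed] [cite: DupuyHilado2025, §3.9, §4.9, §4.12] -/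
theorem slotLicence_settingPrVolSharp_of_movers
    (hmov : ∀ (pp : Nat.Primes) (i : Fin (thetaIndex X).lstar) (x : (thetaIndex X).Fibre (.inr pp)),
      haveI : Fact (pp : ℕ).Prime := ⟨pp.2⟩
      ∃ g ∈ ismDH logv x.1,
        ‖tq pp x‖ ≤ ‖(presAt X hlog pp).φ x (g (((presAt X hlog pp).φ x).symm (t pp i x)))‖) :
    (settingPrVolSharp X hlog M archPk archSub Ψ act Mmod region n lat sig split qData tq t htq0 htq1).SlotLicence := by
  rw [slotLicence_settingPrVolSharp_iff_settingDHVolSharp]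
  exact slotLicence_settingDHVolSharp_of_movers X hlog M archPk archSub Ψ act Mmod region n lat sig split qData tq t htq0 htq1 hmov

end Summit.ABC.IUTFork.Thm311.Real

end
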